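import Literature.Geometry.Lorentzian.KerrSchildMultiplierCurrent
import Literature.Geometry.Lorentzian.KerrSchildKillingEnergy
import Literature.Geometry.Lorentzian.KerrSchildCoord
import Literature.Geometry.Lorentzian.KerrRedShiftEstimate

/-!
# Route ClusterCompleteness — crux `AdiabaticMultiKerrILED`, line `Sketch`:
# the integrated weighted Morawetz inequality between tilted leaves (static tails-cut zone)

Helper file for the crux `stmt-FinalStateConjecture-14310`
(`Summit.FinalStateConjecture.FinalStateConjecture.Theses.ClusterCompleteness.AdiabaticMultiKerrILED`),
line `Sketch`, stub `morawetz_weighted_graph_le` (lead c7, wave 5, Morawetz integration).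

Setting (one zone, zero spin, rest frame): the coefficient field is the tails-cut Kerr–Schild field
`G₀ = KerrSchild.inverseMetric φ (Kerr.nullVector 0)` with profile `φ = χ(2 − r/(8M)) · 2H`
(`χ = Real.smoothTransition`, `r = Kerr.radius 0`), the current is the total Morawetz current
`J = J^X + ¼ L^{ϖ₂} + J_H + J^T` of a `C²` function `Φ`, the weight is the STATIC cut-off
`Wt = χ(u₂/ε − 1) · χ(2 − ‖x⃗‖²/R²)` (`u₂ = Kerr.horizonFn M 0`), and `𝔅` is the designed good bulk
(a quadratic form in `∂Φ`, `Φ` with coefficients depending on `r`). The lab slices are the tilted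
leaves `{x⁰ = t + F(x⃗)}` of a `C²` height `F`, with conormal `n = Kerr.graphConormal F`.

* `weightedGraphFlux_integral_le_of_bulk` — the abstract step with a good bulk AND an error term:
  for a weight `W` vanishing off a closed `K` whose slab points are spatially bounded with a
  property `P`, a current `J` with `W J ∈ C¹`, a continuous `ℓ` vanishing off `K` and a
  continuous `e ≥ 0` vanishing off `K` with `ℓ − e ≤ ∑ ∂(W J)` at the slab points with `P`,
  `∫_{u ∈ (0,s]} ∫ ℓ ≤ (flux through {x⁰ = F}) − (flux through {x⁰ = s + F}) + ∫_{u ∈ (0,s]} ∫ e`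
  for the weighted fluxes `∫ W (−∑ J^μ n_μ)` (`E4.graphFlux_add_integral_le_of_divergence_le` for
  the current `−W J`, and the passage from ball integrals to integrals over `ℝ³`);
* `continuous_morawetzZerothCoeff` — the zeroth-order coefficient
  `s ↦ 𝟙_{s ≥ 7M} M(s − 7M)/(4s⁵)` of `𝔅` is continuous on `ℝ` (it vanishes at `s = 7M`);
* `continuousAt_morawetzBulk` — `𝔅` is continuous at every point with `r > 0` (`Φ ∈ C²`);
* `morawetz_weighted_graph_le` — **the registered stub**: the support set
  `K = {ε ≤ u₂} ∩ {‖x⃗‖² ≤ 2R²}` is closed, `Wt = 0` off `K`, on `K` one has `r > 2M`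
  (`u₂ ≥ ε > 0`) and `‖x⃗‖ ≤ 2R`; `Wt · 𝔅` is continuous on `ℝ⁴` (a product of continuous
  functions at points `r > M`, identically zero near `{r ≤ M}` where the horizon factor vanishes);
  then the abstract step with `ℓ = Wt · 𝔅`.

Dafermos–Rodnianski–Shlapentokh-Rothman arXiv:1402.7034, §2.3.2 (the energy identity of a current
between leaves, (ingeneralform2)); Dafermos–Rodnianski arXiv:0811.0354, §4.1 (the Morawetz
`X`-estimate for Schwarzschild). [folklore]
-/

noncomputable section

-- the doubled `FinalStateConjecture.FinalStateConjecture` path component trips dupNamespace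
set_option linter.dupNamespace false

open Set Filter Metric MeasureTheory
open scoped BigOperators Topology
open Literature.Geometry.Lorentzian

namespace Summit.FinalStateConjecture.FinalStateConjecture.Theorems

/-! ### The abstract weighted graph energy inequality with a good bulk and an error term -/

/-- **Weighted graph energy inequality with good bulk and source, abstract form.** Let `K ⊆ ℝ⁴` be
closed, `W` a weight vanishing off `K`, `J` a current with `W J^μ ∈ C¹(ℝ⁴)`, `F` a `C²` height and
`s ≥ 0`. Assume the points of `K` in the slab `{F(x⃗) ≤ x⁰ ≤ s + F(x⃗)}` have `‖x⃗‖ ≤ ρ` and a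
property `P`, and that `ℓ − e ≤ ∑_μ ∂_μ (W J^μ)` at the slab points with `P`, for a continuous `ℓ`
vanishing off `K` and a continuous `e ≥ 0` vanishing off `K`. Then
`∫_{u ∈ (0, s]} ∫ ℓ(u + F(y), y) dy du` is at most `∫ W (−∑_μ J^μ n_μ)` over the leaf `{x⁰ = F}`
minus the same integral over `{x⁰ = s + F}` plus `∫_{u ∈ (0, s]} ∫ e(u + F(y), y) dy du`
(`n = dt − dF`): the energy inequality `E4.graphFlux_add_integral_le_of_divergence_le` for the
current `−W J`, all integrands vanishing for `‖y‖ > ρ`.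
Dafermos–Rodnianski–Shlapentokh-Rothman arXiv:1402.7034, §2.3.2 (ingeneralform2). [folklore] -/
theorem weightedGraphFlux_integral_le_of_bulk {K : Set E4} (hKc : IsClosed K) {W : E4 → ℝ}
    {J : E4 → Fin 4 → ℝ} (hJ1 : ∀ μ, ContDiff ℝ 1 fun y ↦ W y * J y μ)
    (hWK : ∀ x, x ∉ K → W x = 0) {F : E3 → ℝ} (hF : ContDiff ℝ 2 F) {s ρ : ℝ} {P : E4 → Prop}
    (hρ : ∀ x ∈ K, F (E4.spatial x) ≤ x 0 → x 0 ≤ s + F (E4.spatial x) →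
      E4.spatialNorm x ≤ ρ ∧ P x)
    {ℓ e : E4 → ℝ} (hℓc : Continuous ℓ) (hℓK : ∀ x, x ∉ K → ℓ x = 0) (hec : Continuous e)
    (he0 : ∀ x, 0 ≤ e x) (heK : ∀ x, x ∉ K → e x = 0)
    (hdiv : ∀ x, F (E4.spatial x) ≤ x 0 → x 0 ≤ s + F (E4.spatial x) → P x →
      ℓ x - e x ≤ ∑ μ, fderiv ℝ (fun y ↦ W y * J y μ) x (E4.basisVector μ))
    (hs0 : 0 ≤ s) :
    ∫ u in Set.Ioc 0 s, ∫ y : E3, ℓ (E4.ofTimeSpace (u + F y) y) ≤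
      (∫ y : E3, W (E4.ofTimeSpace (0 + F y) y) *
          (-∑ μ, J (E4.ofTimeSpace (0 + F y) y) μ * Kerr.graphConormal F y μ)) -
        (∫ y : E3, W (E4.ofTimeSpace (s + F y) y) *
          (-∑ μ, J (E4.ofTimeSpace (s + F y) y) μ * Kerr.graphConormal F y μ)) +
        ∫ u in Set.Ioc 0 s, ∫ y : E3, e (E4.ofTimeSpace (u + F y) y) := by
  -- the negated weighted current `J' = −W J`
  set J' : Fin 4 → E4 → ℝ := fun μ y ↦ -(W y * J y μ) with hJ'
  have hJ'1 : ∀ μ, ContDiff ℝ 1 (J' μ) := fun μ ↦ (hJ1 μ).neg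
  have hJ'K : ∀ μ x, x ∉ K → J' μ x = 0 := fun μ x hx ↦ by
    simp only [hJ', hWK x hx, zero_mul, neg_zero]
  have hρ' : ∀ x ∈ K, F (E4.spatial x) ≤ x 0 → x 0 ≤ s + F (E4.spatial x) →
      E4.spatialNorm x ≤ ρ := fun x hx h1 h2 ↦ (hρ x hx h1 h2).1
  have hdiv' : ∀ x ∈ K, F (E4.spatial x) ≤ x 0 → x 0 ≤ s + F (E4.spatial x) →
      ∑ μ, fderiv ℝ (J' μ) x (E4.basisVector μ) ≤ -ℓ x + e x := by
    intro x hx h1 h2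
    have h := hdiv x h1 h2 (hρ x hx h1 h2).2
    have he : ∀ μ, fderiv ℝ (J' μ) x = -fderiv ℝ (fun y ↦ W y * J y μ) x := fun μ ↦ by
      simp only [hJ', fderiv_fun_neg]
    simp only [he, neg_apply, Finset.sum_neg_distrib]
    linarith
  have key := E4.graphFlux_add_integral_le_of_divergence_le hKc hJ'1 hJ'K hF hρ' hℓc hec hℓK
    he0 hdiv' hs0 le_rfl
  -- off the ball `‖y‖ ≤ ρ` the leaf points `(t + F y, y)`, `0 ≤ t ≤ s`, are not in `K`
  have hnotK : ∀ (t : ℝ) (y : E3), 0 ≤ t → t ≤ s → y ∉ closedBall (0 : E3) ρ →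
      E4.ofTimeSpace (t + F y) y ∉ K := by
    intro t y ht0 hts hy hK
    refine hy ?_
    have h := (hρ _ hK
      (by simp only [E4.spatial_ofTimeSpace, E4.ofTimeSpace_apply_zero]; linarith)
      (by simp only [E4.spatial_ofTimeSpace, E4.ofTimeSpace_apply_zero]; linarith)).1
    rw [E4.spatialNorm_ofTimeSpace] at h
    exact mem_closedBall_zero_iff.mpr h
  -- from ball integrals of `∑ J'^μ n_μ` to integrals of `W (−∑ J^μ n_μ)` over `ℝ³`
  have hleaf : ∀ t, 0 ≤ t → t ≤ s →
      (∫ y in closedBall (0 : E3) ρ, ∑ μ, J' μ (E4.ofTimeSpace (t + F y) y) *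
        Kerr.graphConormal F y μ) = ∫ y : E3, W (E4.ofTimeSpace (t + F y) y) *
          (-∑ μ, J (E4.ofTimeSpace (t + F y) y) μ * Kerr.graphConormal F y μ) := by
    intro t ht0 hts
    rw [setIntegral_eq_integral_of_forall_compl_eq_zero]
    · congr 1
      funext y
      simp only [hJ']
      rw [mul_neg, Finset.mul_sum, ← Finset.sum_neg_distrib]
      exact Finset.sum_congr rfl fun μ _ ↦ by ring
    · intro y hy
      have hW : W (E4.ofTimeSpace (t + F y) y) = 0 := hWK _ (hnotK t y ht0 hts hy)
      simp only [hJ', hW, zero_mul, neg_zero, Finset.sum_const_zero]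
  -- from ball integrals of a density vanishing off `K` to integrals over `ℝ³`
  have hbulk : ∀ {g : E4 → ℝ}, (∀ x, x ∉ K → g x = 0) →
      (∫ u in Set.Ioc 0 s, ∫ y in closedBall (0 : E3) ρ, g (E4.ofTimeSpace (u + F y) y)) =
        ∫ u in Set.Ioc 0 s, ∫ y : E3, g (E4.ofTimeSpace (u + F y) y) := by
    intro g hgK
    refine setIntegral_congr_fun measurableSet_Ioc fun u hu ↦ ?_
    exact setIntegral_eq_integral_of_forall_compl_eq_zero fun y hy ↦
      hgK _ (hnotK u y hu.1.le hu.2 hy)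
  rw [hleaf s hs0 le_rfl, hleaf 0 le_rfl hs0, hbulk hℓK, hbulk heK] at key
  linarith

/-! ### Continuity of the good bulk `𝔅` -/

/-- **The zeroth-order coefficient of the good bulk is continuous**: for `M > 0` the function
`s ↦ 𝟙_{7M ≤ s} · M(s − 7M)/(4s⁵)` is continuous on `ℝ` (on `{7M ≤ s}` the rational function is
continuous since `s ≥ 7M > 0`, and it vanishes at the junction `s = 7M`). [folklore] -/
theorem continuous_morawetzZerothCoeff {M : ℝ} (hM : 0 < M) :
    Continuous fun s : ℝ ↦ if 7 * M ≤ s then M * (s - 7 * M) / (4 * s ^ 5) else 0 := by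
  refine continuous_if_le continuous_const continuous_id (fun s hs ↦ ?_) continuousOn_const
    fun s hs ↦ ?_
  · have hs' : 7 * M ≤ s := hs
    have hs0 : 0 < s := by linarith
    have h : ContinuousAt (fun s : ℝ ↦ M * (s - 7 * M) / (4 * s ^ 5)) s :=
      (continuousAt_const.mul (continuousAt_id.sub continuousAt_const)).div
        (continuousAt_const.mul (continuousAt_id.pow 5)) (mul_ne_zero four_ne_zero
          (pow_ne_zero 5 hs0.ne'))
    exact h.continuousWithinAt
  · have h : s - 7 * M = 0 := by linarith
    simp only [h, mul_zero, zero_div]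

/-- **The good bulk `𝔅` is continuous at points with `r > 0`** (`M > 0`, `Φ ∈ C²(ℝ⁴)`): its
coefficients are rational functions of `r = Kerr.radius 0` with denominators powers of `r`, times
the smooth profile `φ = χ(2 − r/(8M)) · 2H` (`H` is smooth on `{r > 0}`, `Kerr.contDiffAt_scalarH`)
and the continuous zeroth-order coefficient `continuous_morawetzZerothCoeff`, applied to the
continuous first derivatives `∂_μ Φ` and to `Φ`. [folklore] -/
theorem continuousAt_morawetzBulk {M : ℝ} {Φ : E4 → ℝ} {x : E4} (hM : 0 < M)
    (hΦ : ContDiff ℝ 2 Φ) (hx : 0 < Kerr.radius 0 x) :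
    ContinuousAt (fun x : E4 ↦ ((Kerr.radius 0 x - 2 * M) * M ^ 3 * (Kerr.radius 0 x - 3 * M) ^ 2 /
          (2 * Kerr.radius 0 x ^ 7)) * fderiv ℝ Φ x (E4.basisVector 0) ^ 2 +
        (3 * M / (20 * Kerr.radius 0 x ^ 2)) *
          ((1 - (Real.smoothTransition (2 - Kerr.radius 0 x / (8 * M)) * (2 * Kerr.scalarH M 0 x))) *
              (∑ i : Fin 3, x i.succ * fderiv ℝ Φ x (E4.basisVector i.succ)) / Kerr.radius 0 x +
            (Real.smoothTransition (2 - Kerr.radius 0 x / (8 * M)) * (2 * Kerr.scalarH M 0 x)) *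
              fderiv ℝ Φ x (E4.basisVector 0)) ^ 2 +
        ((Kerr.radius 0 x - 3 * M) ^ 2 / (8 * Kerr.radius 0 x ^ 3)) *
          ((∑ i : Fin 3, fderiv ℝ Φ x (E4.basisVector i.succ) ^ 2) -
            ((∑ i : Fin 3, x i.succ * fderiv ℝ Φ x (E4.basisVector i.succ)) / Kerr.radius 0 x) ^ 2) +
        (if 7 * M ≤ Kerr.radius 0 x then M * (Kerr.radius 0 x - 7 * M) / (4 * Kerr.radius 0 x ^ 5)
          else 0) * Φ x ^ 2) x := by
  have hr : ContinuousAt (Kerr.radius 0) x := (Kerr.continuous_radius 0).continuousAt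
  have hdc : ∀ μ, Continuous fun y ↦ fderiv ℝ Φ y (E4.basisVector μ) := fun μ ↦
    (hΦ.continuous_fderiv two_ne_zero).clm_apply continuous_const
  have hd : ∀ μ, ContinuousAt (fun y ↦ fderiv ℝ Φ y (E4.basisVector μ)) x := fun μ ↦
    (hdc μ).continuousAt
  have hΦc : ContinuousAt Φ x := hΦ.continuous.continuousAt
  have hφ : ContinuousAt (fun y ↦ Real.smoothTransition (2 - Kerr.radius 0 y / (8 * M)) *
      (2 * Kerr.scalarH M 0 y)) x :=
    (Real.smoothTransition.continuous.continuousAt.comp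
      (continuousAt_const.sub (hr.div_const _))).mul
      (continuousAt_const.mul (Kerr.contDiffAt_scalarH M 0 hx (n := 0)).continuousAt)
  have hS : ContinuousAt
      (fun y : E4 ↦ ∑ i : Fin 3, y i.succ * fderiv ℝ Φ y (E4.basisVector i.succ)) x :=
    (continuous_finsetSum _ fun i _ ↦
      ((Kerr.contDiff_coord i.succ (n := 0)).continuous).mul (hdc i.succ)).continuousAt
  have hS2 : ContinuousAt (fun y : E4 ↦ ∑ i : Fin 3, fderiv ℝ Φ y (E4.basisVector i.succ) ^ 2) x :=
    (continuous_finsetSum _ fun i _ ↦ (hdc i.succ).pow 2).continuousAt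
  have hk : ContinuousAt (fun y ↦ if 7 * M ≤ Kerr.radius 0 y then
      M * (Kerr.radius 0 y - 7 * M) / (4 * Kerr.radius 0 y ^ 5) else 0) x :=
    ((continuous_morawetzZerothCoeff hM).comp (Kerr.continuous_radius 0)).continuousAt
  have hx0 : Kerr.radius 0 x ≠ 0 := hx.ne'
  have h1 : ContinuousAt (fun y ↦ (Kerr.radius 0 y - 2 * M) * M ^ 3 * (Kerr.radius 0 y - 3 * M) ^ 2 /
      (2 * Kerr.radius 0 y ^ 7) * fderiv ℝ Φ y (E4.basisVector 0) ^ 2) x :=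
    ((((hr.sub continuousAt_const).mul continuousAt_const).mul
      ((hr.sub continuousAt_const).pow 2)).div (continuousAt_const.mul (hr.pow 7))
      (mul_ne_zero two_ne_zero (pow_ne_zero 7 hx0))).mul ((hd 0).pow 2)
  have h2 : ContinuousAt (fun y ↦ 3 * M / (20 * Kerr.radius 0 y ^ 2) *
      ((1 - Real.smoothTransition (2 - Kerr.radius 0 y / (8 * M)) * (2 * Kerr.scalarH M 0 y)) *
          (∑ i : Fin 3, y i.succ * fderiv ℝ Φ y (E4.basisVector i.succ)) / Kerr.radius 0 y +
        Real.smoothTransition (2 - Kerr.radius 0 y / (8 * M)) * (2 * Kerr.scalarH M 0 y) *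
          fderiv ℝ Φ y (E4.basisVector 0)) ^ 2) x :=
    (continuousAt_const.div (continuousAt_const.mul (hr.pow 2))
      (mul_ne_zero (by norm_num) (pow_ne_zero 2 hx0))).mul
      (((((continuousAt_const.sub hφ).mul hS).div hr hx0).add (hφ.mul (hd 0))).pow 2)
  have h3 : ContinuousAt (fun y ↦ (Kerr.radius 0 y - 3 * M) ^ 2 / (8 * Kerr.radius 0 y ^ 3) *
      ((∑ i : Fin 3, fderiv ℝ Φ y (E4.basisVector i.succ) ^ 2) -
        ((∑ i : Fin 3, y i.succ * fderiv ℝ Φ y (E4.basisVector i.succ)) / Kerr.radius 0 y) ^ 2)) x :=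
    (((hr.sub continuousAt_const).pow 2).div (continuousAt_const.mul (hr.pow 3))
      (mul_ne_zero (by norm_num) (pow_ne_zero 3 hx0))).mul (hS2.sub ((hS.div hr hx0).pow 2))
  have h4 : ContinuousAt (fun y ↦ (if 7 * M ≤ Kerr.radius 0 y then
      M * (Kerr.radius 0 y - 7 * M) / (4 * Kerr.radius 0 y ^ 5) else 0) * Φ y ^ 2) x :=
    hk.mul (hΦc.pow 2)
  exact ((h1.add h2).add h3).add h4

/-! ### The registered stub -/

/-- **The integrated weighted Morawetz inequality between tilted leaves** (crux
`stmt-FinalStateConjecture-14310`, line `Sketch`, stub `morawetz_weighted_graph_le`). For the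
tails-cut zero-spin Kerr–Schild field `G₀`, the total Morawetz current
`J = J^X + ¼ L^{ϖ₂} + J_H + J^T` of a `C²` function `Φ`, the static weight
`Wt = χ(u₂/ε − 1) χ(2 − ‖x⃗‖²/R²)` (`u₂ = Kerr.horizonFn M 0`, `16M ≤ R`) and the designed good bulk
`𝔅`: if `Wt J ∈ C¹(ℝ⁴)`, `e ≥ 0` is continuous and vanishes where `u₂ < ε` or `‖x⃗‖² > 2R²`, and
`Wt 𝔅 − e ≤ ∑_μ ∂_μ(Wt J^μ)` at the points of the slab `{F(x⃗) ≤ x⁰ ≤ s + F(x⃗)}` with `r > 2M`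
(`F ∈ C²`, `0 ≤ s`), then `∫_{u ∈ (0,s]} ∫ Wt 𝔅` over the leaves in between is at most the
weighted flux `∫ Wt (−∑ J^μ n_μ)` through `{x⁰ = F}` minus the one through `{x⁰ = s + F}` plus
`∫_{u ∈ (0,s]} ∫ e` (`n = Kerr.graphConormal F`). Proof: `weightedGraphFlux_integral_le_of_bulk`
with the closed support set `K = {ε ≤ u₂} ∩ {‖x⃗‖² ≤ 2R²}` (off `K` a factor of `Wt` vanishes,
`Real.smoothTransition.zero_of_nonpos`; on `K`, `r > r₊ = 2M` by
`Kerr.rPlus_lt_radius_of_horizonFn_pos` and `‖x⃗‖ ≤ 2R`), the continuity of `Wt 𝔅` on `ℝ⁴`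
(`continuousAt_morawetzBulk` at points `r > M`, identically zero near `{r ≤ M}`) and `ℓ = Wt 𝔅`.
Dafermos–Rodnianski–Shlapentokh-Rothman arXiv:1402.7034, §2.3.2; Dafermos–Rodnianski
arXiv:0811.0354, §4.1. [folklore] -/
theorem morawetz_weighted_graph_le : ∀ (M ε R : ℝ) (F : E3 → ℝ) (Φ : E4 → ℝ) (e : E4 → ℝ) (s : ℝ), let Wt : E4 → ℝ := fun y ↦ (Real.smoothTransition (Kerr.horizonFn M 0 y / ε - 1) * Real.smoothTransition (2 - E4.spatialNorm y ^ 2 / R ^ 2)); let J : E4 → Fin 4 → ℝ := fun y μ ↦ (KerrSchild.multiplierCurrent (KerrSchild.inverseMetric (fun y ↦ Real.smoothTransition (2 - Kerr.radius 0 y / (8 * M)) * (2 * Kerr.scalarH M 0 y)) (Kerr.nullVector 0)) (fun (z : E4) (α : Fin 4) ↦ if α = 0 then (1 - 3 * M / Kerr.radius 0 z) * (Real.smoothTransition (2 - Kerr.radius 0 z / (8 * M)) * (2 * Kerr.scalarH M 0 z)) else (1 - 3 * M / Kerr.radius 0 z) * (1 - (Real.smoothTransition (2 - Kerr.radius 0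 z / (8 * M)) * (2 * Kerr.scalarH M 0 z))) * z α / Kerr.radius 0 z) Φ y μ + 4⁻¹ * KerrSchild.lagrangianCurrent (KerrSchild.inverseMetric (fun y ↦ Real.smoothTransition (2 - Kerr.radius 0 y / (8 * M)) * (2 * Kerr.scalarH M 0 y)) (Kerr.nullVector 0)) (fun z ↦ (fun s ↦ 2 * ((1 - 2 * M / s) * ((2 * s - 3 * M) / s ^ 2 - M ^ 3 * (s - 3 * M) ^ 2 / s ^ 6))) (Kerr.radius 0 z)) Φ y μ + 2⁻¹ * (fun s ↦ if s ≤ 7 * M then 2 * (7 * M - s) ^ 2 * (fun ρ ↦ (-((593459 : ℝ) / 10000000)) + (788874 : ℝ) / 10000000 * ρ - (383061 : ℝ) / 10000000 * ρ ^ 2 + (92031 : ℝ) / 10000000 * ρ ^ 3 - (10985 : ℝ) / 10000000 * ρ ^ 4 + (525 : ℝ) / 10000000 * ρ ^ 5) (s / M) / (M ^ 3 * s) else 0) (Kerr.radius 0 y) * Φ y ^ 2 * (if μ = 0 then (Real.smoothTransition (2 - Kerr.radius 0 y / (8 * M)) * (2 * Kerr.scalarH M 0 y)) else (1 - (Real.smoothTransition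 (2 - Kerr.radius 0 y / (8 * M)) * (2 * Kerr.scalarH M 0 y))) * y μ / Kerr.radius 0 y) + KerrSchild.multiplierCurrent (KerrSchild.inverseMetric (fun y ↦ Real.smoothTransition (2 - Kerr.radius 0 y / (8 * M)) * (2 * Kerr.scalarH M 0 y)) (Kerr.nullVector 0)) KerrSchild.timeField Φ y μ); let B : E4 → ℝ := fun x ↦ (((Kerr.radius 0 x - 2 * M) * M ^ 3 * (Kerr.radius 0 x - 3 * M) ^ 2 / (2 * Kerr.radius 0 x ^ 7)) * fderiv ℝ Φ x (E4.basisVector 0) ^ 2 + (3 * M / (20 * Kerr.radius 0 x ^ 2)) * ((1 - (Real.smoothTransition (2 - Kerr.radius 0 x / (8 * M)) * (2 * Kerr.scalarH M 0 x))) * (∑ i : Fin 3, x i.succ * fderiv ℝ Φ x (E4.basisVector i.succ)) / Kerr.radius 0 x + (Real.smoothTransition (2 - Kerr.radius 0 x / (8 * M)) * (2 * Kerr.scalarH M 0 x)) * fderiv ℝ Φ x (E4.basisVector 0)) ^ 2 + ((Kerr.radius 0 x - 3 * M) ^ 2 / (8 * Kerr.radius 0 x ^ 3)) * ((∑ i :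 Fin 3, fderiv ℝ Φ x (E4.basisVector i.succ) ^ 2) - ((∑ i : Fin 3, x i.succ * fderiv ℝ Φ x (E4.basisVector i.succ)) / Kerr.radius 0 x) ^ 2) + (if 7 * M ≤ Kerr.radius 0 x then M * (Kerr.radius 0 x - 7 * M) / (4 * Kerr.radius 0 x ^ 5) else 0) * Φ x ^ 2); 0 < M → 0 < ε → 16 * M ≤ R → ContDiff ℝ 2 F → (∀ y, ‖fderiv ℝ F y‖ ≤ 2⁻¹) → 0 ≤ s → ContDiff ℝ 2 Φ → (∀ μ : Fin 4, ContDiff ℝ 1 (fun y ↦ Wt y * J y μ)) → Continuous e → (∀ x, 0 ≤ e x) → (∀ x : E4, (Kerr.horizonFn M 0 x < ε ∨ 2 * R ^ 2 < E4.spatialNorm x ^ 2) → e x = 0) → (∀ x : E4, F (E4.spatial x) ≤ x 0 → x 0 ≤ s + F (E4.spatial x) → 2 * M < Kerr.radius 0 x → Wt x * B x - e x ≤ ∑ μ, fderiv ℝ (fun y ↦ Wt y * J y μ) x (E4.basisVector μ)) → ∫ u in Set.Ioc 0 s, ∫ y : E3, Wt (E4.ofTimeSpace (u + F y) y) * B (E4.ofTimeSpace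 (u + F y) y) ≤ (∫ y : E3, Wt (E4.ofTimeSpace (0 + F y) y) * (-∑ μ, J (E4.ofTimeSpace (0 + F y) y) μ * Kerr.graphConormal F y μ)) - (∫ y : E3, Wt (E4.ofTimeSpace (s + F y) y) * (-∑ μ, J (E4.ofTimeSpace (s + F y) y) μ * Kerr.graphConormal F y μ)) + ∫ u in Set.Ioc 0 s, ∫ y : E3, e (E4.ofTimeSpace (u + F y) y) := by
  intro M ε R F Φ e s Wt J B hM hε hR hF _hslope hs hΦ hJ1 he_cont he0 heK hdiv
  have hRpos : 0 < R := by linarith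
  have hrp : 0 < Kerr.rPlus M 0 := by
    rw [Kerr.rPlus_zero_right hM.le]
    positivity
  -- the support set of the weight: closed
  set K : Set E4 := {x | ε ≤ Kerr.horizonFn M 0 x ∧ E4.spatialNorm x ^ 2 ≤ 2 * R ^ 2} with hK
  have hKc : IsClosed K := by
    rw [hK, Set.setOf_and]
    exact (isClosed_le continuous_const (Kerr.continuous_horizonFn M 0)).inter
      (isClosed_le (Kerr.contDiff_spatialNorm_sq (n := 0)).continuous continuous_const)
  -- the weight: explicit form, vanishing off `K` and near the horizon, continuity
  have hWt : ∀ x, Wt x = Real.smoothTransition (Kerr.horizonFn M 0 x / ε - 1) *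
      Real.smoothTransition (2 - E4.spatialNorm x ^ 2 / R ^ 2) := fun x ↦ rfl
  have hWK : ∀ x, x ∉ K → Wt x = 0 := by
    intro x hx
    by_contra hne
    rw [hWt] at hne
    refine hx ⟨(Kerr.lt_horizonFn_of_weight_ne_zero hε (left_ne_zero_of_mul hne)).le, ?_⟩
    by_contra hlt
    refine right_ne_zero_of_mul hne (Real.smoothTransition.zero_of_nonpos ?_)
    rw [sub_nonpos, le_div_iff₀ (by positivity : (0 : ℝ) < R ^ 2)]
    exact (not_le.mp hlt).le
  have hW0 : ∀ y : E4, Kerr.radius 0 y < 2 * M → Wt y = 0 := by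
    intro y hy
    have h1 : Kerr.horizonFn M 0 y ≤ 0 := by
      unfold Kerr.horizonFn
      rw [Kerr.rPlus_zero_right hM.le]
      exact mul_nonpos_iff.mpr (Or.inr ⟨by linarith, (Real.exp_pos _).le⟩)
    have h2 : Kerr.horizonFn M 0 y / ε - 1 ≤ 0 := by
      have : Kerr.horizonFn M 0 y / ε ≤ 0 := div_nonpos_iff.mpr (Or.inr ⟨h1, hε.le⟩)
      linarith
    rw [hWt, Real.smoothTransition.zero_of_nonpos h2, zero_mul]
  have hWc : Continuous Wt := by
    have h : Continuous fun x ↦ Real.smoothTransition (Kerr.horizonFn M 0 x / ε - 1) *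
        Real.smoothTransition (2 - E4.spatialNorm x ^ 2 / R ^ 2) :=
      (Kerr.contDiff_horizonFactor (a := 0) (n := 0) hrp hε).continuous.mul
        (Real.smoothTransition.continuous.comp
          (continuous_const.sub ((Kerr.contDiff_spatialNorm_sq (n := 0)).continuous.div_const _)))
    exact h
  -- slab points of `K`: spatially bounded by `2R`, strictly exterior
  have hρ : ∀ x ∈ K, F (E4.spatial x) ≤ x 0 → x 0 ≤ s + F (E4.spatial x) →
      E4.spatialNorm x ≤ 2 * R ∧ 2 * M < Kerr.radius 0 x := by
    intro x hx _ _
    refine ⟨?_, ?_⟩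
    · have h2 : E4.spatialNorm x ^ 2 ≤ 2 * R ^ 2 := hx.2
      nlinarith [E4.spatialNorm_nonneg x, h2]
    · rw [← Kerr.rPlus_zero_right hM.le]
      exact Kerr.rPlus_lt_radius_of_horizonFn_pos (lt_of_lt_of_le hε hx.1)
  -- the error density vanishes off `K`
  have heK' : ∀ x, x ∉ K → e x = 0 := by
    intro x hx
    refine heK x ?_
    by_contra h
    rw [not_or, not_lt, not_lt] at h
    exact hx h
  -- the good bulk density `Wt 𝔅` is continuous on `ℝ⁴` and vanishes off `K`
  have hℓc : Continuous fun x ↦ Wt x * B x := by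
    rw [continuous_iff_continuousAt]
    intro x
    rcases lt_or_ge M (Kerr.radius 0 x) with hx | hx
    · exact hWc.continuousAt.mul (continuousAt_morawetzBulk hM hΦ (hM.trans hx))
    · have hev : ∀ᶠ y in 𝓝 x, Kerr.radius 0 y < 2 * M :=
        (Kerr.continuous_radius 0).continuousAt.eventually_lt continuousAt_const (by linarith)
      refine Filter.EventuallyEq.continuousAt (y := (0 : ℝ)) ?_
      filter_upwards [hev] with y hy
      rw [hW0 y hy, zero_mul]
  have hℓK : ∀ x, x ∉ K → Wt x * B x = 0 := fun x hx ↦ by rw [hWK x hx, zero_mul]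
  exact weightedGraphFlux_integral_le_of_bulk (K := K) (W := Wt) (J := J)
    (ℓ := fun x ↦ Wt x * B x) (e := e) (P := fun x ↦ 2 * M < Kerr.radius 0 x) (ρ := 2 * R)
    hKc hJ1 hWK hF hρ hℓc hℓK he_cont he0 heK' (fun x h1 h2 hP ↦ hdiv x h1 h2 hP) hs

end Summit.FinalStateConjecture.FinalStateConjecture.Theorems
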